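import Summits.NavierStokesRegularity.NavierStokesRegularity.Theorems.EfficiencyFloorProductionEfficiencyDecayLuDoeringRung
import Summits.NavierStokesRegularity.NavierStokesRegularity.Theorems.NoBlowupToClay
import HarnessLib

/-!
# Crux `EfficiencyFloor.ProductionEfficiencyDecay` (stmt-NavierStokesRegularity-22866): the MEAN FORM of the crux is what
# the route consumes — `MeanEfficiencyDecay ⟺ SuperLerayFloor`, and `MeanEfficiencyDecay ∧ EnstrophyQuarterLaw ⟹ NavierStokesRegularity`

Helper file (`--supports stmt-NavierStokesRegularity-22866`). The crux as filed (and its registered crux-proper stub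
`stub_depletionGivenBudget`, equivalent to it by p585755) is the POINTWISE law: eventually `Ż ≤ εZ³` for every `ε`, i.e. the
every-subwindow inequality `Z(s)⁻² − Z(t)⁻² ≤ ε(t − s)`. The route's deciding theorem `Theses.EfficiencyFloor.closes` uses it
only through `FloorOfEfficiencyDecay` (stmt-22868), i.e. through its `t → T⁻` consequence. This file isolates that consequence
as a statement in the crux's own format and certifies, BY NAME, that it suffices:

* `MeanEfficiencyDecay` (inline, the crux text with the two-time law replaced by the ONE-ENDPOINT law): for every `ε > 0`
  there is `t₁ ∈ [0,T)` with `0 < Z < ⊤` and `Z(s)⁻² ≤ ε·(T − s)` on `[t₁,T)` — equivalently the MEAN Lu–Doering efficiency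
  over `[s,T)`, `(T−s)⁻¹∫_s^T Ż/Z³ = Z(s)⁻²/(2(T−s))`, tends to `0` («every blow-up is enstrophy-super-Leray»,
  `Z(s)²(T−s) → ∞`).
* `superLerayFloor_of_meanEfficiencyDecay` / `meanEfficiencyDecay_of_superLerayFloor`: it is EQUIVALENT to the conclusion of
  `FloorOfEfficiencyDecay` (`∀ K`, eventually `K/√(T−t) < Z(t)`), unconditionally (finiteness of `Z` on `(0,T)` from the
  landed budget stmt-22995, real-analysis step `FloorOfEfficiencyDecay.floor_of_inv_sq_le`).
* `navierStokesRegularity_of_superLerayFloor`, `navierStokesRegularity_of_meanEfficiencyDecay`: either form, together with the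
  residual `EnstrophyQuarterLaw` (stmt-1574), implies the sub-problem Statement `NavierStokesRegularity` — the pincer of
  `closes` re-run without `ProductionEfficiencyDecay`.
* `superLerayFloor_of_productionEfficiencyDecay`, `meanEfficiencyDecay_of_productionEfficiencyDecay`: the filed crux implies
  both (landed stmt-22868 + stmt-22867), so the mean form sits BETWEEN the crux and what the assembly needs.

READING (planner-facing, no item is created here). In the class of enstrophy curves allowed by the landed information
(cubic law `Ż ≤ KZ³`, Leray floor, blow-up), the pointwise crux is STRICTLY stronger than the mean form: e.g.
`Z(t) = (T−t)⁻¹(2 + sin((T−t)⁻¹))` obeys `Ż ≤ 4Z³`, has `Z²(T−t) → ∞` (mean form) and yet `Ż/Z³ ≥ 1/8` at the times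
`T − t = 1/(2πn)` (pointwise form fails) — the extra content of the pointwise law is the exclusion of late enstrophy
OSCILLATIONS at frequency `∼(T−t)⁻²`, which no mechanism of the line addresses and the assembly does not use. The rung
`LerayFloorGap` (stmt-25164) is likewise a floor-type (one-endpoint) statement. HONEST FRAMING: implications between OPEN
statements about a HYPOTHETICAL blow-up plus one re-run of the route's pincer; `ProductionEfficiencyDecay`, its mean form,
`EnstrophyQuarterLaw` and Navier–Stokes regularity stay OPEN; no summit statement is proved. [folklore]
-/

-- the problem directory repeats the summit name (`NavierStokesRegularity/NavierStokesRegularity`)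
set_option linter.dupNamespace false

noncomputable section

namespace Summit.NavierStokesRegularity.NavierStokesRegularity.Theorems

namespace ProductionEfficiencyDecay

namespace MeanForm

open Set MeasureTheory Filter Topology Function
open scoped InnerProductSpace ENNReal
open Literature.Analysis.FluidPDE

/-- From `K/√(T−s) < z` with `K = 1/√ε`, `ε > 0`, `s < T`: `z⁻² < ε·(T − s)` (and `z > 0`). [folklore] -/
theorem inv_sq_lt_of_floor {T ε s z : ℝ} (hε : 0 < ε) (hs : s < T)
    (h : 1 / Real.sqrt ε / Real.sqrt (T - s) < z) : z⁻¹ ^ 2 < ε * (T - s) := by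
  have hTs : 0 < T - s := sub_pos.2 hs
  have ha : 0 < 1 / Real.sqrt ε / Real.sqrt (T - s) := by positivity
  have hz : 0 < z := ha.trans h
  have h1 : z⁻¹ < (1 / Real.sqrt ε / Real.sqrt (T - s))⁻¹ := (inv_lt_inv₀ hz ha).2 h
  have h2 : (1 / Real.sqrt ε / Real.sqrt (T - s))⁻¹ = Real.sqrt ε * Real.sqrt (T - s) := by
    rw [inv_div, one_div, div_inv_eq_mul, mul_comm]
  rw [h2] at h1
  have h3 : (Real.sqrt ε * Real.sqrt (T - s)) ^ 2 = ε * (T - s) := by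
    rw [mul_pow, Real.sq_sqrt hε.le, Real.sq_sqrt hTs.le]
  rw [← h3]
  exact pow_lt_pow_left₀ h1 (inv_nonneg.2 hz.le) two_ne_zero

/-- **Mean efficiency decay ⟹ super-Leray floor.** If along every maximal classical Leray–Hopf rapidly-decaying-datum
solution, for every `ε > 0`, eventually `0 < Z < ⊤` and `Z(s)⁻² ≤ ε·(T−s)`, then for every `K`, eventually
`K/√(T−t) < Z(t)` (the conclusion of `FloorOfEfficiencyDecay`, verbatim). [folklore] -/
theorem superLerayFloor_of_meanEfficiencyDecay
    (hM : ∀ (ν T : ℝ), 0 < ν → 0 < T → ∀ (u : ℝ → EuclideanSpace ℝ (Fin 3) → EuclideanSpace ℝ (Fin 3)) (p : ℝ →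
      EuclideanSpace ℝ (Fin 3) → ℝ), Literature.Analysis.FluidPDE.IsMaximalSmoothSolution ν 0 u p T →
      Literature.Analysis.FluidPDE.IsLerayHopfOn T ν 0 (u 0) u → Literature.Analysis.FluidPDE.HasRapidSpatialDecay
      (u 0) → ∀ ε : ℝ, 0 < ε → ∃ t₁ ∈ Set.Ico 0 T, ∀ s ∈ Set.Ico t₁ T, (0 < ∫⁻ x,
      ‖Literature.Analysis.FluidPDE.curl (u s) x‖ₑ ^ 2 ∧ ∫⁻ x, ‖Literature.Analysis.FluidPDE.curl (u s) x‖ₑ ^ 2 <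
      ⊤) ∧ ((∫⁻ x, ‖Literature.Analysis.FluidPDE.curl (u s) x‖ₑ ^ 2).toReal)⁻¹ ^ 2 ≤ ε * (T - s)) :
    ∀ (ν T : ℝ), 0 < ν → 0 < T → ∀ (u : ℝ → EuclideanSpace ℝ (Fin 3) → EuclideanSpace ℝ (Fin 3)) (p : ℝ →
      EuclideanSpace ℝ (Fin 3) → ℝ), Literature.Analysis.FluidPDE.IsMaximalSmoothSolution ν 0 u p T →
      Literature.Analysis.FluidPDE.IsLerayHopfOn T ν 0 (u 0) u → Literature.Analysis.FluidPDE.HasRapidSpatialDecay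
      (u 0) → ∀ K : ℝ, ∀ᶠ t in nhdsWithin T (Set.Iio T), ENNReal.ofReal (K / Real.sqrt (T - t)) < ∫⁻ x,
      ‖Literature.Analysis.FluidPDE.curl (u t) x‖ₑ ^ 2 := by
  intro ν T hν hT u p hmax hLH hdec K
  set ε : ℝ := 1 / (K ^ 2 + 1) with hεdef
  have hε : 0 < ε := by positivity
  obtain ⟨t₁, ht₁, hlaw⟩ := hM ν T hν hT u p hmax hLH hdec ε hε
  have hIco : ∀ᶠ t in 𝓝[<] T, t ∈ Ico t₁ T := Ico_mem_nhdsLT ht₁.2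
  filter_upwards [hIco] with s hs
  obtain ⟨⟨hpos, htop⟩, hinv⟩ := hlaw s hs
  set z : ℝ := (∫⁻ x, ‖curl (u s) x‖ₑ ^ 2).toReal with hz
  have hzpos : 0 < z := ENNReal.toReal_pos hpos.ne' htop.ne
  have hfloor : K / Real.sqrt (T - s) < z := FloorOfEfficiencyDecay.floor_of_inv_sq_le hzpos hs.2 hinv
  calc ENNReal.ofReal (K / Real.sqrt (T - s)) < ENNReal.ofReal z := (ENNReal.ofReal_lt_ofReal_iff hzpos).2 hfloor
    _ = ∫⁻ x, ‖curl (u s) x‖ₑ ^ 2 := ENNReal.ofReal_toReal htop.ne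

/-- **Super-Leray floor ⟹ mean efficiency decay.** Conversely, if for every `K` eventually `K/√(T−t) < Z(t)`, then for every
`ε > 0` there is `t₁ ∈ [0,T)` with `0 < Z < ⊤` and `Z(s)⁻² ≤ ε·(T − s)` on `[t₁,T)` (take `K = 1/√ε`; finiteness of `Z` on
`(0,T)` is the landed budget stmt-22995). [folklore] -/
theorem meanEfficiencyDecay_of_superLerayFloor
    (hF : ∀ (ν T : ℝ), 0 < ν → 0 < T → ∀ (u : ℝ → EuclideanSpace ℝ (Fin 3) → EuclideanSpace ℝ (Fin 3)) (p : ℝ →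
      EuclideanSpace ℝ (Fin 3) → ℝ), Literature.Analysis.FluidPDE.IsMaximalSmoothSolution ν 0 u p T →
      Literature.Analysis.FluidPDE.IsLerayHopfOn T ν 0 (u 0) u → Literature.Analysis.FluidPDE.HasRapidSpatialDecay
      (u 0) → ∀ K : ℝ, ∀ᶠ t in nhdsWithin T (Set.Iio T), ENNReal.ofReal (K / Real.sqrt (T - t)) < ∫⁻ x,
      ‖Literature.Analysis.FluidPDE.curl (u t) x‖ₑ ^ 2) :
    ∀ (ν T : ℝ), 0 < ν → 0 < T → ∀ (u : ℝ → EuclideanSpace ℝ (Fin 3) → EuclideanSpace ℝ (Fin 3)) (p : ℝ →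
      EuclideanSpace ℝ (Fin 3) → ℝ), Literature.Analysis.FluidPDE.IsMaximalSmoothSolution ν 0 u p T →
      Literature.Analysis.FluidPDE.IsLerayHopfOn T ν 0 (u 0) u → Literature.Analysis.FluidPDE.HasRapidSpatialDecay
      (u 0) → ∀ ε : ℝ, 0 < ε → ∃ t₁ ∈ Set.Ico 0 T, ∀ s ∈ Set.Ico t₁ T, (0 < ∫⁻ x,
      ‖Literature.Analysis.FluidPDE.curl (u s) x‖ₑ ^ 2 ∧ ∫⁻ x, ‖Literature.Analysis.FluidPDE.curl (u s) x‖ₑ ^ 2 <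
      ⊤) ∧ ((∫⁻ x, ‖Literature.Analysis.FluidPDE.curl (u s) x‖ₑ ^ 2).toReal)⁻¹ ^ 2 ≤ ε * (T - s) := by
  intro ν T hν hT u p hmax hLH hdec ε hε
  obtain ⟨c, -, hB⟩ := EnstrophyBudget.main
  obtain ⟨Zr, Pr, Sr, hZ⟩ := hB ν T hν hT u p hmax hLH hdec
  have h1 := hF ν T hν hT u p hmax hLH hdec (1 / Real.sqrt ε)
  obtain ⟨t₀, ht₀T, hsub⟩ := mem_nhdsLT_iff_exists_Ioo_subset.1 h1
  set t₁ : ℝ := (max t₀ 0 + T) / 2 with ht₁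
  have hm : max t₀ 0 < T := max_lt ht₀T hT
  have ht₁I : t₁ ∈ Ioo 0 T := ⟨by rw [ht₁]; linarith [le_max_right t₀ 0], by rw [ht₁]; linarith⟩
  refine ⟨t₁, ⟨ht₁I.1.le, ht₁I.2⟩, fun s hs => ?_⟩
  have ht₀s : t₀ < s := by
    have : max t₀ 0 < t₁ := by rw [ht₁]; linarith
    exact (le_max_left t₀ 0).trans_lt (this.trans_le hs.1)
  have hsI : s ∈ Ioo 0 T := ⟨ht₁I.1.trans_le hs.1, hs.2⟩
  have hfl : ENNReal.ofReal (1 / Real.sqrt ε / Real.sqrt (T - s)) < ∫⁻ x, ‖curl (u s) x‖ₑ ^ 2 := hsub ⟨ht₀s, hs.2⟩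
  have heq : (∫⁻ x, ‖curl (u s) x‖ₑ ^ 2) = ENNReal.ofReal (Zr s) := (hZ s hsI).1
  have htop : (∫⁻ x, ‖curl (u s) x‖ₑ ^ 2) < ⊤ := by rw [heq]; exact ENNReal.ofReal_lt_top
  have hpos : 0 < ∫⁻ x, ‖curl (u s) x‖ₑ ^ 2 := lt_of_le_of_lt bot_le hfl
  refine ⟨⟨hpos, htop⟩, ?_⟩
  rw [heq, ENNReal.toReal_ofReal (hZ s hsI).2.1]
  rw [heq, ENNReal.ofReal_lt_ofReal_iff'] at hfl
  exact (inv_sq_lt_of_floor hε hs.2 hfl.1).le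

/-- **The pincer with the floor as hypothesis**: the super-Leray floor (conclusion of `FloorOfEfficiencyDecay`, for every
maximal classical Leray–Hopf rapidly-decaying-datum solution) and the residual `EnstrophyQuarterLaw` (stmt-1574) imply the
sub-problem Statement — `Theses.EfficiencyFloor.closes` re-run without `ProductionEfficiencyDecay`. An IMPLICATION between
open statements; nothing is proved about Navier–Stokes regularity. [folklore] -/
theorem navierStokesRegularity_of_superLerayFloor
    (hF : ∀ (ν T : ℝ), 0 < ν → 0 < T → ∀ (u : ℝ → EuclideanSpace ℝ (Fin 3) → EuclideanSpace ℝ (Fin 3)) (p : ℝ →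
      EuclideanSpace ℝ (Fin 3) → ℝ), Literature.Analysis.FluidPDE.IsMaximalSmoothSolution ν 0 u p T →
      Literature.Analysis.FluidPDE.IsLerayHopfOn T ν 0 (u 0) u → Literature.Analysis.FluidPDE.HasRapidSpatialDecay
      (u 0) → ∀ K : ℝ, ∀ᶠ t in nhdsWithin T (Set.Iio T), ENNReal.ofReal (K / Real.sqrt (T - t)) < ∫⁻ x,
      ‖Literature.Analysis.FluidPDE.curl (u t) x‖ₑ ^ 2)
    (hQ : Summit.NavierStokesRegularity.NavierStokesRegularity.Theses.EfficiencyFloor.EnstrophyQuarterLaw) :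
    NavierStokesRegularity := by
  apply Summit.NavierStokesRegularity.NavierStokesRegularity.Theorems.navierStokesRegularity_of_noBlowup
  intro ν T hν hT0 u p hcl hLH hdec
  by_contra hext
  have hmax : IsMaximalSmoothSolution ν 0 u p T := ⟨hcl, hext⟩
  obtain ⟨K, hK⟩ := hQ ν T hν hT0 u p hmax hLH hdec
  have hSL := hF ν T hν hT0 u p hmax hLH hdec K
  have hlt : ∀ᶠ t in 𝓝[<] T, t < T := self_mem_nhdsWithin
  have hge : ∀ᶠ t in 𝓝[<] T, 0 ≤ t := eventually_nhdsWithin_of_eventually_nhds (eventually_ge_nhds hT0)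
  obtain ⟨t, ht, htT, ht0⟩ := (hSL.and (hlt.and hge)).exists
  exact absurd (hK t ⟨ht0, htT⟩) (not_le.2 ht)

/-- **Mean efficiency decay ∧ quarter law ⟹ `NavierStokesRegularity`** (BY NAME for the residual and the conclusion): the
route's pincer needs only the MEAN form of the crux. An IMPLICATION between open statements. [folklore] -/
theorem navierStokesRegularity_of_meanEfficiencyDecay
    (hM : ∀ (ν T : ℝ), 0 < ν → 0 < T → ∀ (u : ℝ → EuclideanSpace ℝ (Fin 3) → EuclideanSpace ℝ (Fin 3)) (p : ℝ →
      EuclideanSpace ℝ (Fin 3) → ℝ), Literature.Analysis.FluidPDE.IsMaximalSmoothSolution ν 0 u p T →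
      Literature.Analysis.FluidPDE.IsLerayHopfOn T ν 0 (u 0) u → Literature.Analysis.FluidPDE.HasRapidSpatialDecay
      (u 0) → ∀ ε : ℝ, 0 < ε → ∃ t₁ ∈ Set.Ico 0 T, ∀ s ∈ Set.Ico t₁ T, (0 < ∫⁻ x,
      ‖Literature.Analysis.FluidPDE.curl (u s) x‖ₑ ^ 2 ∧ ∫⁻ x, ‖Literature.Analysis.FluidPDE.curl (u s) x‖ₑ ^ 2 <
      ⊤) ∧ ((∫⁻ x, ‖Literature.Analysis.FluidPDE.curl (u s) x‖ₑ ^ 2).toReal)⁻¹ ^ 2 ≤ ε * (T - s))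
    (hQ : Summit.NavierStokesRegularity.NavierStokesRegularity.Theses.EfficiencyFloor.EnstrophyQuarterLaw) :
    NavierStokesRegularity :=
  navierStokesRegularity_of_superLerayFloor (superLerayFloor_of_meanEfficiencyDecay hM) hQ

/-- **The filed crux implies the floor** (landed stmt-22868 fed with the landed stmt-22867). [folklore] -/
theorem superLerayFloor_of_productionEfficiencyDecay
    (hE : Summit.NavierStokesRegularity.NavierStokesRegularity.Theses.EfficiencyFloor.ProductionEfficiencyDecay) :
    ∀ (ν T : ℝ), 0 < ν → 0 < T → ∀ (u : ℝ → EuclideanSpace ℝ (Fin 3) → EuclideanSpace ℝ (Fin 3)) (p : ℝ →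
      EuclideanSpace ℝ (Fin 3) → ℝ), Literature.Analysis.FluidPDE.IsMaximalSmoothSolution ν 0 u p T →
      Literature.Analysis.FluidPDE.IsLerayHopfOn T ν 0 (u 0) u → Literature.Analysis.FluidPDE.HasRapidSpatialDecay
      (u 0) → ∀ K : ℝ, ∀ᶠ t in nhdsWithin T (Set.Iio T), ENNReal.ofReal (K / Real.sqrt (T - t)) < ∫⁻ x,
      ‖Literature.Analysis.FluidPDE.curl (u t) x‖ₑ ^ 2 :=
  fun _ _ hν hT _ _ hmax hLH hdec K =>
    FloorOfEfficiencyDecay.main hE efficiencyFloor_blowupEnstrophyUnbounded_proof hν hT hmax hLH hdec K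

/-- **The filed (pointwise) crux implies its mean form.** [folklore] -/
theorem meanEfficiencyDecay_of_productionEfficiencyDecay
    (hE : Summit.NavierStokesRegularity.NavierStokesRegularity.Theses.EfficiencyFloor.ProductionEfficiencyDecay) :
    ∀ (ν T : ℝ), 0 < ν → 0 < T → ∀ (u : ℝ → EuclideanSpace ℝ (Fin 3) → EuclideanSpace ℝ (Fin 3)) (p : ℝ →
      EuclideanSpace ℝ (Fin 3) → ℝ), Literature.Analysis.FluidPDE.IsMaximalSmoothSolution ν 0 u p T →
      Literature.Analysis.FluidPDE.IsLerayHopfOn T ν 0 (u 0) u → Literature.Analysis.FluidPDE.HasRapidSpatialDecay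
      (u 0) → ∀ ε : ℝ, 0 < ε → ∃ t₁ ∈ Set.Ico 0 T, ∀ s ∈ Set.Ico t₁ T, (0 < ∫⁻ x,
      ‖Literature.Analysis.FluidPDE.curl (u s) x‖ₑ ^ 2 ∧ ∫⁻ x, ‖Literature.Analysis.FluidPDE.curl (u s) x‖ₑ ^ 2 <
      ⊤) ∧ ((∫⁻ x, ‖Literature.Analysis.FluidPDE.curl (u s) x‖ₑ ^ 2).toReal)⁻¹ ^ 2 ≤ ε * (T - s) :=
  meanEfficiencyDecay_of_superLerayFloor (superLerayFloor_of_productionEfficiencyDecay hE)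

end MeanForm

end ProductionEfficiencyDecay

end Summit.NavierStokesRegularity.NavierStokesRegularity.Theorems

end
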